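import Mathlib
import Summits.CriticalPhenomena.PercolationContinuityZ3.Theorems.PercNearOneGluingNoHeavyLowerTailOrientedAntipodalHallOrderedAssignment

/-!
# The oriented antipodal Hall count by PETAL ENLARGEMENT (two groups, no rigidity theorem needed)

Helper file for crux `stmt-CriticalPhenomena-4575` (`NoHeavyLowerTail`, route `PercNearOneGluingNoHeavy`),
new-inequality factory seat `prim-ineq-gen-3` (gen 11).  Everything here is PROVED.

New idea (gen 11, memo FINDINGS-gen11.md F11-6).  All certificates so far count the bads against the family `K₀` of CO-GOODS above a bad
(`f F = B`, `f (S \ F) = A`, `F` misses a bad) using plain vectors in `ℚ^{K₀}`.  If a set `Σ` of petals never occurs as the complement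
label `b X` of a chosen member, one may ENLARGE the coordinate family to
  `𝒢 = {F ⊆ S : f F ∈ {B} ∪ {C_σ : σ ∈ Σ}, f (S \ F) = A, F misses a bad}`  (still down-closed),
and adjoin to the first group the plain vectors of the new coordinates `𝒳 = 𝒢 \ K₀` themselves.  In `ℚ^𝒢` more cross meets are
certified (a meet of two members with the SAME petal `a = a' ∈ Σ` now lies in `𝒢`), the pseudo-class `𝒳` is `B`-orthogonal to every member
(`E ∩ M = ∅` would force `C_σ ≤ C_{b M}`), and all its differences lie in `𝒢` (down-closure).  With TWO groups — `P = M(D₁) ∪ 𝒳` (all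
differences in `𝒢`) and an ORDERED group `Q = M(D₂)` — pairwise `B`-orthogonality alone gives `#P + #Q ≤ #𝒢` (the defect `V_P ⊓ V_Q` is
isotropic), i.e. `#D₁ + #𝒳 + #D₂ ≤ #K₀ + #𝒳`.

**Theorem (`card_le_card_goods_above_of_enlarged_assignment`).**  `f` monotone; bads in two groups `D₁, D₂` with bits `cpl` and oriented labels
`a, b`; a set `Sig` of petals with `b X ∉ Sig` for all bads; group `D₁`: all complemented, `a X ∈ Sig`, and `a X ≠ b X'`, `b X ≠ a X'`; group `D₂`:
the ordered-middle-group conditions; across: `b X ≠ b Y` and not (`a X = b Y ∧ a Y = b X`).  Then `#D₁ + #D₂ ≤ #{goods above a bad}`.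
On four petals this certifies the four 5-type classes left open by the three-group method, e.g. `TT₄ ∖ {(0,3)} = {01,02,12,13,23}` with
`Sig = {2}`, `D₁ = D₁₂` (complemented), `D₂ = D₀₁ᶜ, D₀₂ᶜ ; D₁₃, D₂₃` (file `…OrientedAntipodalHallFiveTypeClasses.lean`).
(prim-ineq-gen-3 gen 11, 2026-08-20.)
-/

namespace Summit.CriticalPhenomena.PercolationContinuityZ3.Theorems

namespace OrientedAntipodalHall

open Finset AntipodalStrongHarris AntipodalStrongHarris.Lab ThreeFamilyRank Module
open scoped FinsetFamily

variable {α : Type*} [DecidableEq α] {k : ℕ}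

/-- A label below a petal is `B` or that petal. -/
theorem eq_bot_or_eq_of_le_petal {σ : Fin k} {c : Lab k} (h : c ≤ petal σ) : c = bot ∨ c = petal σ := by
  rw [le_def] at h
  rcases h with h | h | h
  · exact Or.inl h
  · cases h
  · exact Or.inr h

/-- **The oriented antipodal Hall count from a two-group assignment with petal enlargement.**  See the module docstring. -/
theorem card_le_card_goods_above_of_enlarged_assignment (S : Finset α) {f : Finset α → Lab k}
    (hf : ∀ ⦃X Y : Finset α⦄, X ⊆ Y → f X ≤ f Y) (D₁ D₂ : Finset (Finset α))
    (cpl : Finset α → Bool) (a b : Finset α → Fin k) (Sig : Finset (Fin k))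
    (hlab : ∀ X ∈ D₁ ∪ D₂, X ⊆ S ∧ (cpl X = false → f X = petal (a X) ∧ f (S \ X) = petal (b X)) ∧
      (cpl X = true → f (S \ X) = petal (a X) ∧ f X = petal (b X)))
    (hSig : ∀ X ∈ D₁ ∪ D₂, b X ∉ Sig)
    (hE₁ : ∀ X ∈ D₁, cpl X = true ∧ a X ∈ Sig)
    (hW₁ : ∀ X ∈ D₁, ∀ X' ∈ D₁, a X ≠ b X' ∧ b X ≠ a X')
    (hW₂ : ∀ X ∈ D₂, ∀ X' ∈ D₂, a X ≠ b X' ∧ b X ≠ a X' ∧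
      (cpl X = true → cpl X' = false → ¬ (a X = a X' ∧ b X = b X')))
    (hC : ∀ X ∈ D₁, ∀ Y ∈ D₂, b X ≠ b Y ∧ ¬ (a X = b Y ∧ a Y = b X)) :
    #D₁ + #D₂ ≤ #{U ∈ S.powerset | f U = top ∧ f (S \ U) = bot ∧ ∃ X ∈ D₁ ∪ D₂, X ⊆ U} := by
  -- the member of a bad
  set M : Finset α → Finset α := fun X => if cpl X = true then S \ X else X with hMdef
  have mem₁ : ∀ X ∈ D₁, X ∈ D₁ ∪ D₂ := fun X hX => mem_union_left _ hX
  have mem₂ : ∀ Y ∈ D₂, Y ∈ D₁ ∪ D₂ := fun Y hY => mem_union_right _ hY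
  have hXS : ∀ X ∈ D₁ ∪ D₂, X ⊆ S := fun X hX => (hlab X hX).1
  have hMS : ∀ X ∈ D₁ ∪ D₂, M X ⊆ S := by
    intro X hX
    simp only [hMdef]
    split_ifs
    · exact sdiff_subset
    · exact hXS X hX
  have hMa : ∀ X ∈ D₁ ∪ D₂, f (M X) = petal (a X) := by
    intro X hX
    simp only [hMdef]
    by_cases hc : cpl X = true
    · rw [if_pos hc]; exact ((hlab X hX).2.2 hc).1
    · rw [if_neg hc]; exact ((hlab X hX).2.1 (by simpa using hc)).1
  have hMb : ∀ X ∈ D₁ ∪ D₂, f (S \ M X) = petal (b X) := by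
    intro X hX
    simp only [hMdef]
    by_cases hc : cpl X = true
    · rw [if_pos hc, Finset.sdiff_sdiff_eq_self (hXS X hX)]; exact ((hlab X hX).2.2 hc).2
    · rw [if_neg hc]; exact ((hlab X hX).2.1 (by simpa using hc)).2
  have hlabel_of_subset : ∀ X ∈ D₁ ∪ D₂, ∀ X' ∈ D₁ ∪ D₂, M X ⊆ M X' → a X = a X' ∧ b X = b X' := by
    intro X hX X' hX' hsub
    constructor
    · exact eq_of_petal_le_petal (by rw [← hMa X hX, ← hMa X' hX']; exact hf hsub)
    · exact (eq_of_petal_le_petal (by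
        rw [← hMb X' hX', ← hMb X hX]; exact hf (sdiff_subset_sdiff le_rfl hsub))).symm
  have below : ∀ {X F : Finset α}, X ⊆ S → F ⊆ S \ X → X ⊆ S \ F :=
    fun hXS hF => subset_sdiff_of_subset_sdiff' hXS hF
  have badM : ∀ X ∈ D₁ ∪ D₂, cpl X = true → ∀ {F : Finset α}, F ⊆ M X → X ⊆ S \ F := by
    intro X hX hc F hF
    simp only [hMdef, if_pos hc] at hF
    exact below (hXS X hX) hF
  have badM' : ∀ X ∈ D₁ ∪ D₂, cpl X = false → ∀ {F : Finset α}, F ⊆ S \ M X → X ⊆ S \ F := by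
    intro X hX hc F hF
    have hc' : ¬ cpl X = true := by simp [hc]
    simp only [hMdef, if_neg hc'] at hF
    exact below (hXS X hX) hF
  -- the ENLARGED family of coordinates: co-goods above a bad, and `Sig`-half-co-goods above a bad
  set 𝒢 : Finset (Finset α) := {F ∈ S.powerset | f (S \ F) = top ∧ (f F = bot ∨ ∃ σ ∈ Sig, f F = petal σ) ∧
    ∃ X ∈ D₁ ∪ D₂, X ⊆ S \ F} with h𝒢
  have h𝒢S : ∀ E ∈ 𝒢, E ⊆ S := fun E hE => by
    rw [h𝒢, mem_filter, mem_powerset] at hE; exact hE.1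
  have h𝒢down : ∀ E ∈ 𝒢, ∀ F, F ⊆ E → F ∈ 𝒢 := by
    intro E hE F hFE
    rw [h𝒢, mem_filter, mem_powerset] at hE ⊢
    obtain ⟨hES, htop, hlow, X, hX, hXE⟩ := hE
    refine ⟨hFE.trans hES, eq_top_of_top_le ?_, ?_, X, hX, hXE.trans (sdiff_subset_sdiff le_rfl hFE)⟩
    · rw [← htop]; exact hf (sdiff_subset_sdiff le_rfl hFE)
    · rcases hlow with hb | ⟨σ, hσ, hEσ⟩
      · left; exact eq_bot_of_le_bot (by rw [← hb]; exact hf hFE)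
      · rcases eq_bot_or_eq_of_le_petal (show f F ≤ petal σ by rw [← hEσ]; exact hf hFE) with h | h
        · exact Or.inl h
        · exact Or.inr ⟨σ, hσ, h⟩
  -- certification with two witnesses on each side (gives a genuine co-good)
  have cert : ∀ {F U₁ U₂ V₁ V₂ : Finset α} {p q r s : Fin k}, F ⊆ S → p ≠ q → r ≠ s →
      f U₁ = petal p → f U₂ = petal q → U₁ ⊆ S \ F → U₂ ⊆ S \ F →
      f V₁ = petal r → f V₂ = petal s → F ⊆ V₁ → F ⊆ V₂ →
      (∃ X ∈ D₁ ∪ D₂, X ⊆ S \ F) → F ∈ 𝒢 := by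
    intro F U₁ U₂ V₁ V₂ p q r s hFS hpq hrs hU₁ hU₂ h₁ h₂ hV₁ hV₂ h₃ h₄ hX
    obtain ⟨htop, hbot⟩ := good_sdiff_of_witnesses S hf hFS hpq hrs hU₁ hU₂ h₁ h₂ hV₁ hV₂ h₃ h₄
    rw [Finset.sdiff_sdiff_eq_self hFS] at hbot
    rw [h𝒢, mem_filter, mem_powerset]
    exact ⟨hFS, htop, Or.inl hbot, hX⟩
  -- certification with two witnesses below the complement and ONE `Sig`-petal witness above `F`
  have cert₁ : ∀ {F U₁ U₂ V : Finset α} {p q σ : Fin k}, F ⊆ S → p ≠ q → σ ∈ Sig →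
      f U₁ = petal p → f U₂ = petal q → U₁ ⊆ S \ F → U₂ ⊆ S \ F → f V = petal σ → F ⊆ V →
      (∃ X ∈ D₁ ∪ D₂, X ⊆ S \ F) → F ∈ 𝒢 := by
    intro F U₁ U₂ V p q σ hFS hpq hσ hU₁ hU₂ h₁ h₂ hV hFV hX
    rw [h𝒢, mem_filter, mem_powerset]
    refine ⟨hFS, eq_top_of_petal_le hpq (by rw [← hU₁]; exact hf h₁) (by rw [← hU₂]; exact hf h₂), ?_, hX⟩
    rcases eq_bot_or_eq_of_le_petal (show f F ≤ petal σ by rw [← hV]; exact hf hFV) with h | h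
    · exact Or.inl h
    · exact Or.inr ⟨σ, hσ, h⟩
  -- a single ordered difference `M X \ M X'` (certified when `X` is complemented or `X'` is plain)
  have hdiff : ∀ X ∈ D₁ ∪ D₂, ∀ X' ∈ D₁ ∪ D₂, a X ≠ b X' → b X ≠ a X' →
      (cpl X = true ∨ cpl X' = false) → M X \ M X' ∈ 𝒢 := by
    intro X hX X' hX' hab hba hc
    have hFS : M X \ M X' ⊆ S := sdiff_subset.trans (hMS X hX)
    have hF1 : M X \ M X' ⊆ M X := sdiff_subset
    have hF2 : M X \ M X' ⊆ S \ M X' := sdiff_subset_sdiff (hMS X hX) le_rfl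
    have hbad : ∃ X₀ ∈ D₁ ∪ D₂, X₀ ⊆ S \ (M X \ M X') := by
      rcases hc with hc | hc
      · exact ⟨X, hX, badM X hX hc hF1⟩
      · exact ⟨X', hX', badM' X' hX' hc hF2⟩
    exact cert hFS hba hab (hMb X hX) (hMa X' hX') (sdiff_subset_sdiff le_rfl hF1)
      (below (hMS X' hX') hF2) (hMa X hX) (hMb X' hX') hF1 hF2 hbad
  -- the families
  set P : Finset (Finset α) := D₁.image M with hPdef
  set 𝒳 : Finset (Finset α) := 𝒢.filter (fun F => f F ≠ bot) with h𝒳def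
  set K₀ : Finset (Finset α) := 𝒢.filter (fun F => f F = bot) with hK₀def
  set D₂c : Finset (Finset α) := D₂.filter (fun X => cpl X = true) with hD₂c
  set D₂p : Finset (Finset α) := D₂.filter (fun X => cpl X = false) with hD₂p
  set Q₁ : Finset (Finset α) := D₂c.image M with hQ₁def
  set Q₂ : Finset (Finset α) := D₂p.image M with hQ₂def
  have hD₂c_sub : ∀ X ∈ D₂c, X ∈ D₂ := fun X hX => (mem_filter.mp hX).1
  have hD₂p_sub : ∀ X ∈ D₂p, X ∈ D₂ := fun X hX => (mem_filter.mp hX).1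
  have hD₂split : D₂ = D₂c ∪ D₂p := by
    ext X
    simp only [hD₂c, hD₂p, mem_union, mem_filter]
    constructor
    · intro hX
      by_cases hc : cpl X = true
      · exact Or.inl ⟨hX, hc⟩
      · exact Or.inr ⟨hX, by simpa using hc⟩
    · rintro (⟨hX, -⟩ | ⟨hX, -⟩) <;> exact hX
  have hQeq : D₂.image M = Q₁ ∪ Q₂ := by
    rw [hQ₁def, hQ₂def, ← image_union, ← hD₂split]
  -- elements of 𝒳
  have h𝒳 : ∀ E ∈ 𝒳, E ∈ 𝒢 ∧ E ⊆ S ∧ f (S \ E) = top ∧ ∃ σ ∈ Sig, f E = petal σ := by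
    intro E hE
    obtain ⟨hE𝒢, hne⟩ := mem_filter.mp hE
    have hE' := hE𝒢
    rw [h𝒢, mem_filter, mem_powerset] at hE'
    obtain ⟨hES, htop, hlow, -⟩ := hE'
    rcases hlow with h | h
    · exact absurd h hne
    · exact ⟨hE𝒢, hES, htop, h⟩
  -- group one: all differences in 𝒢
  have hP𝒳 : ∀ U ∈ P ∪ 𝒳, ∀ U' ∈ P ∪ 𝒳, U \ U' ∈ 𝒢 := by
    intro U hU U' hU'
    rcases mem_union.mp hU with hU | hU
    · obtain ⟨X, hX, rfl⟩ := mem_image.mp hU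
      have hX3 := mem₁ X hX
      obtain ⟨hcX, haX⟩ := hE₁ X hX
      rcases mem_union.mp hU' with hU' | hU'
      · obtain ⟨X', hX', rfl⟩ := mem_image.mp hU'
        obtain ⟨hab, hba⟩ := hW₁ X hX X' hX'
        exact hdiff X hX3 X' (mem₁ X' hX') hab hba (Or.inl hcX)
      · -- `M X \ E`
        obtain ⟨-, hES, -, σ, hσ, hEσ⟩ := h𝒳 U' hU'
        have hFS : M X \ U' ⊆ S := sdiff_subset.trans (hMS X hX3)
        have hF1 : M X \ U' ⊆ M X := sdiff_subset
        have h2 : U' ⊆ S \ (M X \ U') := by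
          intro x hx
          exact mem_sdiff.mpr ⟨hES hx, fun h => (mem_sdiff.mp h).2 hx⟩
        have hbσ : b X ≠ σ := fun h => hSig X hX3 (h ▸ hσ)
        exact cert₁ hFS hbσ haX (hMb X hX3) hEσ (sdiff_subset_sdiff le_rfl hF1) h2 (hMa X hX3) hF1
          ⟨X, hX3, badM X hX3 hcX hF1⟩
    · obtain ⟨hU𝒢, -⟩ := h𝒳 U hU
      exact h𝒢down U hU𝒢 _ sdiff_subset
  -- group two (ordered)
  have hWblock : ∀ D : Finset (Finset α), (∀ X ∈ D, X ∈ D₁ ∪ D₂) →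
      (∀ X ∈ D, ∀ X' ∈ D, cpl X = cpl X' ∧ a X ≠ b X' ∧ b X ≠ a X') →
      ∀ U ∈ D.image M, ∀ U' ∈ D.image M, U \ U' ∈ 𝒢 := by
    intro D hD hW U hU U' hU'
    obtain ⟨X, hX, rfl⟩ := mem_image.mp hU
    obtain ⟨X', hX', rfl⟩ := mem_image.mp hU'
    obtain ⟨hcc, hab, hba⟩ := hW X hX X' hX'
    refine hdiff X (hD X hX) X' (hD X' hX') hab hba ?_
    by_cases hc : cpl X = true
    · exact Or.inl hc
    · right; rw [← hcc]; simpa using hc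
  have hQ₁₁ : ∀ U ∈ Q₁, ∀ U' ∈ Q₁, U \ U' ∈ 𝒢 :=
    hWblock D₂c (fun X hX => mem₂ X (hD₂c_sub X hX)) (fun X hX X' hX' => by
      obtain ⟨hab, hba, -⟩ := hW₂ X (hD₂c_sub X hX) X' (hD₂c_sub X' hX')
      exact ⟨by rw [(mem_filter.mp hX).2, (mem_filter.mp hX').2], hab, hba⟩)
  have hQ₂₂ : ∀ U ∈ Q₂, ∀ U' ∈ Q₂, U \ U' ∈ 𝒢 :=
    hWblock D₂p (fun X hX => mem₂ X (hD₂p_sub X hX)) (fun X hX X' hX' => by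
      obtain ⟨hab, hba, -⟩ := hW₂ X (hD₂p_sub X hX) X' (hD₂p_sub X' hX')
      exact ⟨by rw [(mem_filter.mp hX).2, (mem_filter.mp hX').2], hab, hba⟩)
  have hQ₁₂ : ∀ U ∈ Q₁, ∀ U' ∈ Q₂, U \ U' ∈ 𝒢 ∧ ¬ U ⊆ U' := by
    intro U hU U' hU'
    obtain ⟨X, hX, rfl⟩ := mem_image.mp hU
    obtain ⟨X', hX', rfl⟩ := mem_image.mp hU'
    have hc : cpl X = true := (mem_filter.mp hX).2
    have hc' : cpl X' = false := (mem_filter.mp hX').2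
    have hX2 := hD₂c_sub X hX; have hX'2 := hD₂p_sub X' hX'
    obtain ⟨hab, hba, hne⟩ := hW₂ X hX2 X' hX'2
    exact ⟨hdiff X (mem₂ X hX2) X' (mem₂ X' hX'2) hab hba (Or.inl hc),
      fun hsub => hne hc hc' (hlabel_of_subset X (mem₂ X hX2) X' (mem₂ X' hX'2) hsub)⟩
  -- cross meets: nonempty members of 𝒢
  have hPQ : ∀ U ∈ P ∪ 𝒳, ∀ U' ∈ Q₁ ∪ Q₂, U ∩ U' ∈ 𝒢 ∧ (U ∩ U').Nonempty := by
    intro U hU U' hU'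
    rw [← hQeq] at hU'
    obtain ⟨Y, hY, rfl⟩ := mem_image.mp hU'
    have hY3 := mem₂ Y hY
    rcases mem_union.mp hU with hU | hU
    · obtain ⟨X, hX, rfl⟩ := mem_image.mp hU
      have hX3 := mem₁ X hX
      obtain ⟨hcX, haX⟩ := hE₁ X hX
      obtain ⟨hbb, hnopp⟩ := hC X hX Y hY
      have hF1 : M X ∩ M Y ⊆ M X := inter_subset_left
      have hF2 : M X ∩ M Y ⊆ M Y := inter_subset_right
      have hFS : M X ∩ M Y ⊆ S := hF1.trans (hMS X hX3)
      refine ⟨cert₁ hFS hbb haX (hMb X hX3) (hMb Y hY3) (sdiff_subset_sdiff le_rfl hF1)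
        (sdiff_subset_sdiff le_rfl hF2) (hMa X hX3) hF1 ⟨X, hX3, badM X hX3 hcX hF1⟩, ?_⟩
      rw [nonempty_iff_ne_empty]
      intro he
      apply hnopp
      constructor
      · have hsub : M X ⊆ S \ M Y := by
          intro x hx
          refine mem_sdiff.mpr ⟨hMS X hX3 hx, fun hxY => ?_⟩
          have : x ∈ M X ∩ M Y := mem_inter.mpr ⟨hx, hxY⟩
          rw [he] at this
          simp at this
        exact eq_of_petal_le_petal (by rw [← hMa X hX3, ← hMb Y hY3]; exact hf hsub)
      · have hsub : M Y ⊆ S \ M X := by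
          intro y hy
          refine mem_sdiff.mpr ⟨hMS Y hY3 hy, fun hyX => ?_⟩
          have : y ∈ M X ∩ M Y := mem_inter.mpr ⟨hyX, hy⟩
          rw [he] at this
          simp at this
        exact eq_of_petal_le_petal (by rw [← hMa Y hY3, ← hMb X hX3]; exact hf hsub)
    · obtain ⟨hU𝒢, hUS, -, σ, hσ, hUσ⟩ := h𝒳 U hU
      refine ⟨h𝒢down U hU𝒢 _ inter_subset_left, ?_⟩
      rw [nonempty_iff_ne_empty]
      intro he
      have hsub : U ⊆ S \ M Y := by
        intro x hx
        refine mem_sdiff.mpr ⟨hUS hx, fun hxY => ?_⟩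
        have : x ∈ U ∩ M Y := mem_inter.mpr ⟨hx, hxY⟩
        rw [he] at this
        simp at this
      have hσb : σ = b Y := eq_of_petal_le_petal (by rw [← hUσ, ← hMb Y hY3]; exact hf hsub)
      exact hSig Y hY3 (hσb ▸ hσ)
  -- cardinalities
  have hcP : #P = #D₁ := by
    apply card_image_of_injOn
    intro X hX X' hX' hXX'
    have hc := (hE₁ X hX).1; have hc' := (hE₁ X' hX').1
    simp only [hMdef, if_pos hc, if_pos hc'] at hXX'
    rw [← Finset.sdiff_sdiff_eq_self (hXS X (mem₁ X hX)), ← Finset.sdiff_sdiff_eq_self (hXS X' (mem₁ X' hX')), hXX']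
  have hinjM : ∀ D : Finset (Finset α), (∀ X ∈ D, X ∈ D₁ ∪ D₂) →
      (∀ X ∈ D, ∀ X' ∈ D, cpl X = cpl X') → #(D.image M) = #D := by
    intro D hD hW
    apply card_image_of_injOn
    intro X hX X' hX' hXX'
    have hcc := hW X hX X' hX'
    simp only [hMdef] at hXX'
    by_cases hc : cpl X = true
    · have hc' : cpl X' = true := by rw [← hcc]; exact hc
      rw [if_pos hc, if_pos hc'] at hXX'
      rw [← Finset.sdiff_sdiff_eq_self (hXS X (hD X hX)), ← Finset.sdiff_sdiff_eq_self (hXS X' (hD X' hX')), hXX']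
    · have hc' : ¬ cpl X' = true := by rw [← hcc]; exact hc
      rw [if_neg hc, if_neg hc'] at hXX'
      exact hXX'
  have hcQ₁ : #Q₁ = #D₂c := hinjM D₂c (fun X hX => mem₂ X (hD₂c_sub X hX)) (fun X hX X' hX' => by
      rw [(mem_filter.mp hX).2, (mem_filter.mp hX').2])
  have hcQ₂ : #Q₂ = #D₂p := hinjM D₂p (fun X hX => mem₂ X (hD₂p_sub X hX)) (fun X hX X' hX' => by
      rw [(mem_filter.mp hX).2, (mem_filter.mp hX').2])
  have hQdisj : Disjoint Q₁ Q₂ := by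
    rw [Finset.disjoint_left]
    intro U hU hU'
    exact (hQ₁₂ U hU U hU').2 le_rfl
  have hD₂disj : Disjoint D₂c D₂p := by
    rw [Finset.disjoint_left]
    intro X hX hX'
    have h1 : cpl X = true := (mem_filter.mp hX).2
    have h2 : cpl X = false := (mem_filter.mp hX').2
    rw [h1] at h2
    exact Bool.noConfusion h2
  have hcQ : #(Q₁ ∪ Q₂) = #D₂ := by
    rw [card_union_of_disjoint hQdisj, hcQ₁, hcQ₂, hD₂split, card_union_of_disjoint hD₂disj]
  have hP𝒳disj : Disjoint P 𝒳 := by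
    rw [Finset.disjoint_left]
    intro U hU hU𝒳
    obtain ⟨X, hX, rfl⟩ := mem_image.mp hU
    obtain ⟨-, -, htop, -⟩ := h𝒳 _ hU𝒳
    rw [hMb X (mem₁ X hX)] at htop
    cases htop
  have hcP𝒳 : #(P ∪ 𝒳) = #D₁ + #𝒳 := by rw [card_union_of_disjoint hP𝒳disj, hcP]
  have h𝒢split : #K₀ + #𝒳 = #𝒢 := by
    rw [hK₀def, h𝒳def]
    exact card_filter_add_card_filter_not (fun F => f F = bot)
  -- dimensions and the two-group count (Theorem A′ from dimensions with an empty third family)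
  have hPfin := finrank_V 𝒢 h𝒢down (P ∪ 𝒳) hP𝒳
  have hQfin := finrank_V_union 𝒢 h𝒢down Q₁ Q₂ hQ₁₁ hQ₂₂ hQ₁₂
  have hRfin : finrank ℚ (V 𝒢 (∅ : Finset (Finset α))) = #(∅ : Finset (Finset α)) :=
    finrank_V 𝒢 h𝒢down ∅ (fun X hX => absurd hX (by simp))
  have hcount := card_add_card_add_card_le_of_finrank 𝒢 h𝒢down (P ∪ 𝒳) (Q₁ ∪ Q₂) ∅ hPfin hQfin hRfin hPQ
    (fun Y _ Z hZ => absurd hZ (by simp)) (fun Z hZ _ _ => absurd hZ (by simp))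
  have hbot : finrank ℚ ↥(V 𝒢 (P ∪ 𝒳) ⊓ V 𝒢 (Q₁ ∪ Q₂) ⊓ V 𝒢 (∅ : Finset (Finset α))) ≤ 0 := by
    have h := Submodule.finrank_mono (inf_le_right : V 𝒢 (P ∪ 𝒳) ⊓ V 𝒢 (Q₁ ∪ Q₂) ⊓ V 𝒢 ∅ ≤ V 𝒢 ∅)
    rw [hRfin, card_empty] at h
    exact h
  -- `K₀` injects into the goods above a bad
  have hK₀S : ∀ F ∈ K₀, F ⊆ S := fun F hF => h𝒢S F (mem_filter.mp hF).1
  have hinjK : Set.InjOn (fun F => S \ F) (K₀ : Set (Finset α)) := by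
    intro F₁ hF₁ F₂ hF₂ h
    have e₁ := Finset.sdiff_sdiff_eq_self (hK₀S F₁ hF₁)
    have e₂ := Finset.sdiff_sdiff_eq_self (hK₀S F₂ hF₂)
    simp only at h
    rw [← e₁, ← e₂, h]
  have himg : K₀.image (fun F => S \ F) ⊆
      {U ∈ S.powerset | f U = top ∧ f (S \ U) = bot ∧ ∃ X ∈ D₁ ∪ D₂, X ⊆ U} := by
    intro U hU
    obtain ⟨F, hF, rfl⟩ := mem_image.mp hU
    obtain ⟨hF𝒢, hFbot⟩ := mem_filter.mp hF
    rw [h𝒢, mem_filter, mem_powerset] at hF𝒢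
    obtain ⟨hFS, htop, -, X, hX, hXF⟩ := hF𝒢
    rw [mem_filter, mem_powerset]
    refine ⟨sdiff_subset, htop, ?_, X, hX, hXF⟩
    rw [Finset.sdiff_sdiff_eq_self hFS]; exact hFbot
  have hK₀le : #K₀ ≤ #{U ∈ S.powerset | f U = top ∧ f (S \ U) = bot ∧ ∃ X ∈ D₁ ∪ D₂, X ⊆ U} := by
    calc #K₀ = #(K₀.image fun F => S \ F) := (card_image_of_injOn hinjK).symm
      _ ≤ _ := card_le_card himg
  rw [hcP𝒳, hcQ, card_empty] at hcount
  omega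

end OrientedAntipodalHall

end Summit.CriticalPhenomena.PercolationContinuityZ3.Theorems
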